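import Literature.Geometry.Lorentzian.TeukolskyOutgoingExpansion
import HarnessLib

/-!
# The formal outgoing series at infinity of the scalar radial Teukolsky ODE: recursion for the
# coefficients and the residual of its truncations (Teixeira da Costa 2020, Lemma 2.2, `s = 0`)

Namespace `Literature.Geometry.Lorentzian.Kerr.Costa2019`. For the homogeneous radial Teukolsky ODE with
`s = 0`, `Δ R″ + 2(r − M) R′ + (K²/Δ − L) R = 0` (`K = ω(r² + a²) − am`, `L = λ + a²ω² − 2amω`;
`Kerr.IsRadialTeukolskySolution M a 0 ω m λ`), the point `r = ∞` is an irregular singular point of rank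
one and the outgoing normal solution is the formal series `e^{iωr} r^{2iMω} Σₖ cₖ r^{−k−1}` of
[Costa2019, Def. 2.3 / Lemma 2.2] (its partial sums are `Costa2019.outgoingP M 0 ω c N` of
`TeukolskyOutgoingExpansion.lean`). This file supplies the ALGEBRA of that series:

* `outgoingSymbol M a ω m λ j k` (`j ≤ 5`): the polynomials `pⱼ(k)` with
  `r²Δ · e^{−iωr} r^{−2iMω} r^{k+1} · 𝓛[e^{iωr} r^{2iMω} r^{−k−1}] = Σ_{j ≤ 5} pⱼ(k) rʲ`
  (`outgoingSymbol_identity`; the degree-6 terms cancel — `(iω)² + ω² = 0` — and `p₅(k) = −2iωk`,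
  which is why the exponent `−1` and the logarithmic phase `2Mω log r` are forced);
* `outgoingCoeff M a ω m λ c₀ : ℕ → ℂ`: THE RECURSION `2iω n cₙ = Σ_{n−5 ≤ k < n} p_{k+5−n}(k) cₖ`, `c₀`
  free (`ω ≠ 0`), and `outgoingDefect` (the five surviving coefficient sums of a truncation);
* `outgoingTruncDefect_eq`: for the truncation at order `N`,
  `Σ_{k ≤ N} cₖ z^{N+1−k} P_k(z) = Σ_{t<5} U_{t+1,N} z^{5−t}` — a polynomial of degree `≤ 5`, all higher
  powers having cancelled by the recursion (induction on `N`);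
* `outgoing_truncation_residual`: consequently the `N`-th partial sum `P_N = outgoingP M 0 ω c N` satisfies
  the radial ODE up to `‖Δ P_N″ + 2(r − M) P_N′ + (K²/Δ − L) P_N‖ ≤ C r^{−N−1}` for `r ≥ 2r₊ + 1`.

Everything is proved (definitions with bodies + theorems). Used by `TeukolskyNormalisedInfinityExists.lean`
(existence of `R_{𝓘⁺}`).

## References
* R. Teixeira da Costa, CMP 378 (2020) 705–781 = arXiv:1910.02854, Def. 2.3 (footnote), Lemma 2.2.
  [Costa2019]
* F. W. J. Olver, *Asymptotics and Special Functions* (1974), Ch. 7 §§1–2 (formal solutions at an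
  irregular singularity of rank one). [Olver1974]
-/

noncomputable section

open Complex Set Finset

namespace Literature.Geometry.Lorentzian.Kerr

namespace Costa2019

/-! ### The symbol of the radial operator on `e^{iωr} r^{2iMω} r^{−k−1}` -/

/-- The polynomials `pⱼ(k)`, `j = 0,…,5`, in
`r²Δ · (e^{iωr} r^{2iMω} r^{−k−1})⁻¹ 𝓛[e^{iωr} r^{2iMω} r^{−k−1}] = Σⱼ pⱼ(k) rʲ` (`s = 0`,
`L = λ + a²ω² − 2amω`); `p₅(k) = −2iωk`. [cite: Costa2019, Lemma 2.2] -/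
def outgoingSymbol (M a ω m lam : ℝ) : ℕ → ℕ → ℂ
  | 0, k => (a : ℂ) ^ 4 * ((k : ℂ) ^ 2 + (3 - 4 * I * M * ω) * k + (2 - 6 * I * M * ω - 4 * M ^ 2 * ω ^ 2))
  | 1, k => -4 * M * a ^ 2 * (k : ℂ) ^ 2 + (-2 * I * a ^ 4 * ω - 10 * M * a ^ 2 + 16 * I * M ^ 2 * a ^ 2 * ω) * k +
      (-2 * I * a ^ 4 * ω - 6 * M * a ^ 2 - 4 * M * a ^ 4 * ω ^ 2 + 20 * I * M ^ 2 * a ^ 2 * ω +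
        16 * M ^ 3 * a ^ 2 * ω ^ 2)
  | 2, k => (2 * a ^ 2 + 4 * M ^ 2) * (k : ℂ) ^ 2 + (4 * a ^ 2 + 8 * M ^ 2 - 16 * I * M ^ 3 * ω) * k +
      (2 * a ^ 2 - a ^ 2 * ((lam + a ^ 2 * ω ^ 2 - 2 * a * m * ω : ℝ) : ℂ) + a ^ 2 * m ^ 2 - 2 * a ^ 3 * ω * m -
        2 * I * M * a ^ 2 * ω + 4 * M ^ 2 + 8 * M ^ 2 * a ^ 2 * ω ^ 2 - 16 * I * M ^ 3 * ω - 16 * M ^ 4 * ω ^ 2)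
  | 3, k => -4 * M * (k : ℂ) ^ 2 + (-4 * I * a ^ 2 * ω - 6 * M + 8 * I * M ^ 2 * ω) * k +
      (-2 * I * a ^ 2 * ω - 2 * M + 2 * M * ((lam + a ^ 2 * ω ^ 2 - 2 * a * m * ω : ℝ) : ℂ) -
        4 * M * a ^ 2 * ω ^ 2 + 8 * I * M ^ 2 * ω)
  | 4, k => (k : ℂ) ^ 2 + (1 + 4 * I * M * ω) * k +
      (-((lam + a ^ 2 * ω ^ 2 - 2 * a * m * ω : ℝ) : ℂ) - 2 * a * ω * m + 8 * M ^ 2 * ω ^ 2)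
  | 5, k => -2 * I * ω * k
  | _, _ => 0

/-- `p₅(k) = −2iωk`. [cite: Costa2019, Lemma 2.2] -/
@[simp] theorem outgoingSymbol_five (M a ω m lam : ℝ) (k : ℕ) :
    outgoingSymbol M a ω m lam 5 k = -2 * I * ω * k := rfl

/-- **THE SYMBOL IDENTITY.** With `θ = iω + 2iMω/r` (logarithmic derivative of the phase
`e^{iωr} r^{2iMω}`), for `r ≠ 0`, `Δ(r) ≠ 0`:
`Δ[(θ² + θ′) − 2θ(k+1)/r + (k+1)(k+2)/r²] + 2(r − M)[θ − (k+1)/r] + K²/Δ − L = (Σⱼ pⱼ(k) rʲ)/(r²Δ)`,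
i.e. the radial operator applied to `e^{iωr} r^{2iMω} r^{−k−1}`, divided by that function.
[cite: Costa2019, Lemma 2.2] -/
theorem outgoingSymbol_identity (M a ω m lam : ℝ) (k : ℕ) {r : ℝ} (hr : r ≠ 0) (hΔ : delta M a r ≠ 0) :
    (delta M a r : ℂ) * (((I * ω + 2 * I * M * ω * (r : ℂ)⁻¹) ^ 2 - 2 * I * M * ω * ((r : ℂ)⁻¹) ^ 2) -
        2 * (I * ω + 2 * I * M * ω * (r : ℂ)⁻¹) * ((k : ℂ) + 1) * (r : ℂ)⁻¹ +
        ((k : ℂ) + 1) * ((k : ℂ) + 2) * ((r : ℂ)⁻¹) ^ 2) +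
      2 * ((r - M : ℝ) : ℂ) * ((I * ω + 2 * I * M * ω * (r : ℂ)⁻¹) - ((k : ℂ) + 1) * (r : ℂ)⁻¹) +
      ((((radialK a ω m r) ^ 2 : ℝ) : ℂ) / (delta M a r : ℂ) -
        ((lam + a ^ 2 * ω ^ 2 - 2 * a * m * ω : ℝ) : ℂ)) =
    (∑ j ∈ range 6, outgoingSymbol M a ω m lam j k * (r : ℂ) ^ j) / ((r : ℂ) ^ 2 * (delta M a r : ℂ)) := by
  have hr' : (r : ℂ) ≠ 0 := by exact_mod_cast hr
  have hΔ' : (delta M a r : ℂ) ≠ 0 := by exact_mod_cast hΔ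
  have hΔe : (delta M a r : ℂ) = (r : ℂ) ^ 2 - 2 * M * r + a ^ 2 := by
    unfold delta; push_cast; ring
  have hK : (radialK a ω m r : ℂ) = (ω : ℂ) * ((r : ℂ) ^ 2 + a ^ 2) - a * m := by
    unfold radialK; push_cast; ring
  simp only [Finset.sum_range_succ, Finset.sum_range_zero, outgoingSymbol, zero_add]
  push_cast
  field_simp
  rw [hΔe, hK]
  ring_nf
  simp only [Complex.I_sq]
  ring

/-! ### The recursion for the coefficients -/

/-- **The coefficients `cₖ` of the outgoing series** `e^{iωr} r^{2iMω} Σ cₖ r^{−k−1}` with `c₀`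
prescribed: `c_{n} = (2iω n)⁻¹ Σ_{k<n, n ≤ k+5} p_{k+5−n}(k) cₖ` (`n ≥ 1`), the condition that the
coefficient of `r^{4−n}` in the residual vanishes. [cite: Costa2019, Lemma 2.2] -/
def outgoingCoeff (M a ω m lam : ℝ) (c₀ : ℂ) : ℕ → ℂ
  | 0 => c₀
  | N + 1 => (2 * I * ω * ((N : ℂ) + 1))⁻¹ *
      ∑ k : Fin (N + 1), if N + 1 ≤ (k : ℕ) + 5 then
        outgoingSymbol M a ω m lam ((k : ℕ) + 5 - (N + 1)) k * outgoingCoeff M a ω m lam c₀ k else 0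

/-- The coefficient sums `U_{t,N} = Σ_{k ≤ N, N+t ≤ k+5} p_{k+5−N−t}(k) cₖ` — the coefficient of `r^{4−N−t}`
in the residual of the truncation at order `N`. [cite: Costa2019, Lemma 2.2] -/
def outgoingDefect (M a ω m lam : ℝ) (c₀ : ℂ) (t N : ℕ) : ℂ :=
  ∑ k ∈ range (N + 1), if N + t ≤ k + 5 then
    outgoingSymbol M a ω m lam (k + 5 - (N + t)) k * outgoingCoeff M a ω m lam c₀ k else 0

section Recursion

variable (M a ω m lam : ℝ) (c₀ : ℂ)

/-- `c₀` is the prescribed leading coefficient. [folklore] -/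
@[simp] theorem outgoingCoeff_zero : outgoingCoeff M a ω m lam c₀ 0 = c₀ := by
  rw [outgoingCoeff]

/-- The recursion: `c_{N+1} = (2iω(N+1))⁻¹ U_{1,N}`. [cite: Costa2019, Lemma 2.2] -/
theorem outgoingCoeff_succ (N : ℕ) :
    outgoingCoeff M a ω m lam c₀ (N + 1) = (2 * I * ω * ((N : ℂ) + 1))⁻¹ * outgoingDefect M a ω m lam c₀ 1 N := by
  rw [outgoingCoeff, outgoingDefect]
  congr 1
  exact (Finset.sum_range fun k => if N + 1 ≤ k + 5 then
    outgoingSymbol M a ω m lam (k + 5 - (N + 1)) k * outgoingCoeff M a ω m lam c₀ k else 0).symm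

/-- THE CANCELLATION built into the recursion: `U_{1,N} = 2iω(N+1) c_{N+1} = −p₅(N+1) c_{N+1}` (`ω ≠ 0`).
[cite: Costa2019, Lemma 2.2] -/
theorem outgoingDefect_one_eq {ω : ℝ} (hω : ω ≠ 0) (M a m lam : ℝ) (c₀ : ℂ) (N : ℕ) :
    outgoingDefect M a ω m lam c₀ 1 N = 2 * I * ω * ((N : ℂ) + 1) * outgoingCoeff M a ω m lam c₀ (N + 1) := by
  rw [outgoingCoeff_succ]
  have hω' : (ω : ℂ) ≠ 0 := by exact_mod_cast hω
  have hN : ((N : ℂ) + 1) ≠ 0 := by exact_mod_cast Nat.succ_ne_zero N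
  have h : (2 * I * ω * ((N : ℂ) + 1)) ≠ 0 :=
    mul_ne_zero (mul_ne_zero (mul_ne_zero two_ne_zero I_ne_zero) hω') hN
  rw [← mul_assoc, mul_inv_cancel₀ h, one_mul]

/-- Shifting the truncation order: `U_{t,N+1} = U_{t+1,N} + p_{5−t}(N+1) c_{N+1}` for `t ≤ 5`. [folklore] -/
theorem outgoingDefect_succ_right {t : ℕ} (ht : t ≤ 5) (N : ℕ) :
    outgoingDefect M a ω m lam c₀ t (N + 1) = outgoingDefect M a ω m lam c₀ (t + 1) N +
      outgoingSymbol M a ω m lam (5 - t) (N + 1) * outgoingCoeff M a ω m lam c₀ (N + 1) := by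
  rw [outgoingDefect, Finset.sum_range_succ, outgoingDefect]
  congr 1
  · refine Finset.sum_congr rfl fun k _ => ?_
    rw [show N + 1 + t = N + (t + 1) by ring]
  · rw [if_pos (by omega)]
    congr 2
    omega

/-- `U_{6,N} = 0` (no term of the truncation reaches that far). [folklore] -/
theorem outgoingDefect_six (N : ℕ) : outgoingDefect M a ω m lam c₀ 6 N = 0 := by
  rw [outgoingDefect]
  refine Finset.sum_eq_zero fun k hk => ?_
  rw [Finset.mem_range] at hk
  rw [if_neg (by omega)]

/-! ### The residual polynomial of a truncation -/

/-- `P_k(z) = Σ_{j ≤ 5} pⱼ(k) zʲ`. [cite: Costa2019, Lemma 2.2] -/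
def outgoingSymbolPoly (k : ℕ) (z : ℂ) : ℂ := ∑ j ∈ range 6, outgoingSymbol M a ω m lam j k * z ^ j

/-- The (rescaled) residual polynomial of the truncation at order `N`:
`D_N(z) = Σ_{k ≤ N} cₖ z^{N+1−k} P_k(z)` (`= z^{N+2} ·` the residual amplitude). [cite: Costa2019, Lemma 2.2] -/
def outgoingTruncDefect (N : ℕ) (z : ℂ) : ℂ :=
  ∑ k ∈ range (N + 1), outgoingCoeff M a ω m lam c₀ k * z ^ (N + 1 - k) * outgoingSymbolPoly M a ω m lam k z

/-- `D_{N+1}(z) = z D_N(z) + c_{N+1} z P_{N+1}(z)`. [folklore] -/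
theorem outgoingTruncDefect_succ (N : ℕ) (z : ℂ) :
    outgoingTruncDefect M a ω m lam c₀ (N + 1) z = z * outgoingTruncDefect M a ω m lam c₀ N z +
      outgoingCoeff M a ω m lam c₀ (N + 1) * z * outgoingSymbolPoly M a ω m lam (N + 1) z := by
  rw [outgoingTruncDefect, Finset.sum_range_succ, outgoingTruncDefect, Finset.mul_sum]
  congr 1
  · refine Finset.sum_congr rfl fun k hk => ?_
    rw [Finset.mem_range] at hk
    rw [show N + 1 + 1 - k = (N + 1 - k) + 1 by omega, pow_succ]
    ring
  · rw [show N + 1 + 1 - (N + 1) = 1 by omega, pow_one]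

/-- **THE RESIDUAL OF A TRUNCATION IS A QUINTIC.** For the recursively defined coefficients (`ω ≠ 0`),
`D_N(z) = Σ_{t<5} U_{t+1,N} z^{5−t}`: all powers `z^{6}, …, z^{N+6}` cancel. (Induction on `N`: the new top
term `p₅(N+1) c_{N+1} z⁶` cancels `U_{1,N} z⁶` by the recursion.) [cite: Costa2019, Lemma 2.2] -/
theorem outgoingTruncDefect_eq {ω : ℝ} (hω : ω ≠ 0) (M a m lam : ℝ) (c₀ : ℂ) (N : ℕ) (z : ℂ) :
    outgoingTruncDefect M a ω m lam c₀ N z =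
      ∑ t ∈ range 5, outgoingDefect M a ω m lam c₀ (t + 1) N * z ^ (5 - t) := by
  induction N with
  | zero =>
    have h5 : outgoingSymbol M a ω m lam 5 0 = 0 := by simp
    simp only [outgoingTruncDefect, outgoingSymbolPoly, outgoingDefect, Finset.sum_range_succ,
      Finset.sum_range_zero, zero_add, outgoingCoeff_zero, h5]
    norm_num
    ring
  | succ N ih =>
    have hc := outgoingDefect_one_eq hω M a m lam c₀ N
    have h6 := outgoingDefect_six M a ω m lam c₀ N
    rw [outgoingTruncDefect_succ, ih]
    simp only [Finset.sum_range_succ, Finset.sum_range_zero, zero_add, outgoingSymbolPoly]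
    rw [outgoingDefect_succ_right M a ω m lam c₀ (t := 1) (by norm_num),
      outgoingDefect_succ_right M a ω m lam c₀ (t := 2) (by norm_num),
      outgoingDefect_succ_right M a ω m lam c₀ (t := 3) (by norm_num),
      outgoingDefect_succ_right M a ω m lam c₀ (t := 4) (by norm_num),
      outgoingDefect_succ_right M a ω m lam c₀ (t := 5) (by norm_num), h6, hc]
    simp only [outgoingSymbol_five]
    norm_num
    ring

/-- SIZE OF THE QUINTIC: for real `r ≥ 1`, `‖D_N(r)‖ ≤ (Σ_{t<5} ‖U_{t+1,N}‖) r⁵`. [folklore] -/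
theorem norm_outgoingTruncDefect_le {ω : ℝ} (hω : ω ≠ 0) (M a m lam : ℝ) (c₀ : ℂ) (N : ℕ) {r : ℝ}
    (hr : 1 ≤ r) :
    ‖outgoingTruncDefect M a ω m lam c₀ N r‖ ≤
      (∑ t ∈ range 5, ‖outgoingDefect M a ω m lam c₀ (t + 1) N‖) * r ^ 5 := by
  rw [outgoingTruncDefect_eq hω, Finset.sum_mul]
  refine (norm_sum_le _ _).trans (Finset.sum_le_sum fun t ht => ?_)
  rw [Finset.mem_range] at ht
  rw [norm_mul, norm_pow, Complex.norm_real, Real.norm_of_nonneg (by linarith)]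
  exact mul_le_mul_of_nonneg_left (pow_le_pow_right₀ hr (by omega)) (norm_nonneg _)

end Recursion

/-! ### The residual of the partial sums `P_N` -/

/-- Real powers: `r^{q−1} = r^q r⁻¹` and `r^{q−2} = r^q r⁻²` (cast to `ℂ`, `r > 0`). [folklore] -/
theorem ofReal_rpow_sub_one_two {r : ℝ} (hr : 0 < r) (q : ℝ) :
    (((r ^ (q - 1)) : ℝ) : ℂ) = ((r ^ q : ℝ) : ℂ) * (r : ℂ)⁻¹ ∧
      (((r ^ (q - 2)) : ℝ) : ℂ) = ((r ^ q : ℝ) : ℂ) * ((r : ℂ)⁻¹) ^ 2 := by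
  constructor
  · rw [Real.rpow_sub_one hr.ne']; push_cast; ring
  · rw [show q - 2 = q - (2 : ℕ) by norm_num, Real.rpow_sub_natCast hr.ne']; push_cast; ring

/-- For `k ≤ N` and `r > 0`: `r^{−k−1} = r^{−N−2} · r^{N+1−k}` (real power times natural power). [folklore] -/
theorem ofReal_rpow_neg_eq {r : ℝ} (hr : 0 < r) {k N : ℕ} (hk : k ≤ N) :
    ((r ^ (-(2 * (0 : ℝ)) - (k : ℝ) - 1) : ℝ) : ℂ) = ((r ^ (-(N : ℝ) - 2) : ℝ) : ℂ) * (r : ℂ) ^ (N + 1 - k) := by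
  have h : (-(2 * (0 : ℝ)) - (k : ℝ) - 1) = (-(N : ℝ) - 2) + ((N + 1 - k : ℕ) : ℝ) := by
    rw [Nat.cast_sub (by omega)]; push_cast; ring
  rw [h, Real.rpow_add hr, Real.rpow_natCast]
  push_cast
  ring

/-- **THE RESIDUAL IDENTITY.** For any coefficient sequence of the form `c = outgoingCoeff … c₀` — in fact
for any `c` — and `r > r₊` (`r > 0`, `Δ > 0`):
`Δ P_N″ + 2(r−M) P_N′ + (K²/Δ − L) P_N = e^{iωr} r^{2iMω} r^{−N−2} D_N(r)/(r²Δ)`.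
[cite: Costa2019, Lemma 2.2] -/
theorem outgoing_truncation_residual_eq (M a ω m lam : ℝ) (c₀ : ℂ) (N : ℕ) {r : ℝ} (hr : 0 < r)
    (hΔ : 0 < delta M a r) :
    (delta M a r : ℂ) * outgoingPDeriv2 M 0 ω (outgoingCoeff M a ω m lam c₀) N r +
        2 * ((r - M : ℝ) : ℂ) * outgoingPDeriv M 0 ω (outgoingCoeff M a ω m lam c₀) N r +
        ((((radialK a ω m r) ^ 2 : ℝ) : ℂ) / (delta M a r : ℂ) -
          ((lam + a ^ 2 * ω ^ 2 - 2 * a * m * ω : ℝ) : ℂ)) * outgoingP M 0 ω (outgoingCoeff M a ω m lam c₀) N r =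
      outgoingPhase M ω r * ((r ^ (-(N : ℝ) - 2) : ℝ) : ℂ) *
        (outgoingTruncDefect M a ω m lam c₀ N r / ((r : ℂ) ^ 2 * (delta M a r : ℂ))) := by
  set c := outgoingCoeff M a ω m lam c₀ with hc
  set θ : ℂ := I * ω + 2 * I * M * ω * (r : ℂ)⁻¹ with hθ
  set V : ℂ := (((radialK a ω m r) ^ 2 : ℝ) : ℂ) / (delta M a r : ℂ) -
    ((lam + a ^ 2 * ω ^ 2 - 2 * a * m * ω : ℝ) : ℂ) with hV
  have hr0 : (r : ℂ) ≠ 0 := by exact_mod_cast hr.ne'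
  have hΔ0 : (delta M a r : ℂ) ≠ 0 := by exact_mod_cast hΔ.ne'
  -- Step 1: everything as ONE sum over `k ≤ N`
  have hsum : (delta M a r : ℂ) * outgoingPDeriv2 M 0 ω c N r + 2 * ((r - M : ℝ) : ℂ) * outgoingPDeriv M 0 ω c N r +
      V * outgoingP M 0 ω c N r =
      outgoingPhase M ω r * ∑ k ∈ range (N + 1), c k * ((r ^ (-(2 * (0 : ℝ)) - (k : ℝ) - 1) : ℝ) : ℂ) *
        ((delta M a r : ℂ) * ((θ ^ 2 - 2 * I * M * ω * ((r : ℂ)⁻¹) ^ 2) -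
            2 * θ * ((k : ℂ) + 1) * (r : ℂ)⁻¹ + ((k : ℂ) + 1) * ((k : ℂ) + 2) * ((r : ℂ)⁻¹) ^ 2) +
          2 * ((r - M : ℝ) : ℂ) * (θ - ((k : ℂ) + 1) * (r : ℂ)⁻¹) + V) := by
    have e1 : ∀ k : ℕ, (((-(2 * (0 : ℝ)) - (k : ℝ) - 1) * r ^ (-(2 * (0 : ℝ)) - (k : ℝ) - 2) : ℝ) : ℂ) =
        ((r ^ (-(2 * (0 : ℝ)) - (k : ℝ) - 1) : ℝ) : ℂ) * (-((k : ℂ) + 1) * (r : ℂ)⁻¹) := by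
      intro k
      have h := (ofReal_rpow_sub_one_two hr (-(2 * (0 : ℝ)) - (k : ℝ) - 1)).1
      rw [show -(2 * (0 : ℝ)) - (k : ℝ) - 1 - 1 = -(2 * (0 : ℝ)) - (k : ℝ) - 2 by ring] at h
      push_cast
      rw [h]
      ring
    have e2 : ∀ k : ℕ, (((-(2 * (0 : ℝ)) - (k : ℝ) - 1) * (-(2 * (0 : ℝ)) - (k : ℝ) - 2) *
        r ^ (-(2 * (0 : ℝ)) - (k : ℝ) - 3) : ℝ) : ℂ) =
        ((r ^ (-(2 * (0 : ℝ)) - (k : ℝ) - 1) : ℝ) : ℂ) * (((k : ℂ) + 1) * ((k : ℂ) + 2) * ((r : ℂ)⁻¹) ^ 2) := by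
      intro k
      have h := (ofReal_rpow_sub_one_two hr (-(2 * (0 : ℝ)) - (k : ℝ) - 1)).2
      rw [show -(2 * (0 : ℝ)) - (k : ℝ) - 1 - 2 = -(2 * (0 : ℝ)) - (k : ℝ) - 3 by ring] at h
      push_cast
      rw [h]
      ring
    -- the three amplitude sums of the tree, rewritten over the common factor `r^{−k−1}`
    have hS1 : outgoingSumDeriv 0 c N r = ∑ k ∈ range (N + 1),
        c k * ((r ^ (-(2 * (0 : ℝ)) - (k : ℝ) - 1) : ℝ) : ℂ) * (-((k : ℂ) + 1) * (r : ℂ)⁻¹) := by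
      unfold outgoingSumDeriv
      exact Finset.sum_congr rfl fun k _ => by rw [e1 k]; ring
    have hS2 : outgoingSumDeriv2 0 c N r = ∑ k ∈ range (N + 1),
        c k * ((r ^ (-(2 * (0 : ℝ)) - (k : ℝ) - 1) : ℝ) : ℂ) * (((k : ℂ) + 1) * ((k : ℂ) + 2) * ((r : ℂ)⁻¹) ^ 2) := by
      unfold outgoingSumDeriv2
      exact Finset.sum_congr rfl fun k _ => by rw [e2 k]; ring
    have hS0 : outgoingSum 0 c N r = ∑ k ∈ range (N + 1), c k * ((r ^ (-(2 * (0 : ℝ)) - (k : ℝ) - 1) : ℝ) : ℂ) := rfl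
    -- distribute the right-hand side
    have key : ∀ k : ℕ, c k * ((r ^ (-(2 * (0 : ℝ)) - (k : ℝ) - 1) : ℝ) : ℂ) *
        ((delta M a r : ℂ) * ((θ ^ 2 - 2 * I * M * ω * ((r : ℂ)⁻¹) ^ 2) -
            2 * θ * ((k : ℂ) + 1) * (r : ℂ)⁻¹ + ((k : ℂ) + 1) * ((k : ℂ) + 2) * ((r : ℂ)⁻¹) ^ 2) +
          2 * ((r - M : ℝ) : ℂ) * (θ - ((k : ℂ) + 1) * (r : ℂ)⁻¹) + V) =
        ((delta M a r : ℂ) * (θ ^ 2 - 2 * I * M * ω * ((r : ℂ)⁻¹) ^ 2) + 2 * ((r - M : ℝ) : ℂ) * θ + V) *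
            (c k * ((r ^ (-(2 * (0 : ℝ)) - (k : ℝ) - 1) : ℝ) : ℂ)) +
          ((delta M a r : ℂ) * (2 * θ) + 2 * ((r - M : ℝ) : ℂ)) *
            (c k * ((r ^ (-(2 * (0 : ℝ)) - (k : ℝ) - 1) : ℝ) : ℂ) * (-((k : ℂ) + 1) * (r : ℂ)⁻¹)) +
          (delta M a r : ℂ) *
            (c k * ((r ^ (-(2 * (0 : ℝ)) - (k : ℝ) - 1) : ℝ) : ℂ) * (((k : ℂ) + 1) * ((k : ℂ) + 2) * ((r : ℂ)⁻¹) ^ 2)) := by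
      intro k; ring
    rw [Finset.sum_congr rfl fun k _ => key k, Finset.sum_add_distrib, Finset.sum_add_distrib, ← Finset.mul_sum,
      ← Finset.mul_sum, ← Finset.mul_sum, ← hS0, ← hS1, ← hS2]
    simp only [outgoingPDeriv2, outgoingPDeriv, outgoingP, ← hθ]
    ring
  rw [hsum]
  -- Step 2: the symbol identity termwise and the factorisation `r^{−k−1} = r^{−N−2} r^{N+1−k}`
  have hterm : ∀ k ∈ range (N + 1), c k * ((r ^ (-(2 * (0 : ℝ)) - (k : ℝ) - 1) : ℝ) : ℂ) *
      ((delta M a r : ℂ) * ((θ ^ 2 - 2 * I * M * ω * ((r : ℂ)⁻¹) ^ 2) -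
          2 * θ * ((k : ℂ) + 1) * (r : ℂ)⁻¹ + ((k : ℂ) + 1) * ((k : ℂ) + 2) * ((r : ℂ)⁻¹) ^ 2) +
        2 * ((r - M : ℝ) : ℂ) * (θ - ((k : ℂ) + 1) * (r : ℂ)⁻¹) + V) =
      ((r ^ (-(N : ℝ) - 2) : ℝ) : ℂ) * ((c k * (r : ℂ) ^ (N + 1 - k) * outgoingSymbolPoly M a ω m lam k r) /
        ((r : ℂ) ^ 2 * (delta M a r : ℂ))) := by
    intro k hk
    rw [Finset.mem_range] at hk
    rw [hθ, hV, outgoingSymbol_identity M a ω m lam k hr.ne' hΔ.ne', ofReal_rpow_neg_eq hr (N := N) (by omega),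
      outgoingSymbolPoly]
    field_simp
  rw [Finset.sum_congr rfl hterm, ← Finset.mul_sum, ← Finset.sum_div, outgoingTruncDefect]
  ring

/-- **THE TRUNCATIONS SATISFY THE ODE TO ORDER `r^{−N−1}`.** For `M > 0`, `|a| < M`, `ω ≠ 0`, any `c₀`
and `N`, with `c = outgoingCoeff M a ω m λ c₀`, there is `C` such that for all `r ≥ 2r₊ + 1`:
`‖Δ P_N″ + 2(r−M) P_N′ + (K²/Δ − L) P_N‖ ≤ C r^{−N−1}` (`P_N = outgoingP M 0 ω c N`). [cite: Costa2019, Lemma 2.2] -/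
theorem outgoing_truncation_residual {M a : ℝ} (hM : 0 < M) (ha : |a| < M) {ω : ℝ} (hω : ω ≠ 0)
    (m lam : ℝ) (c₀ : ℂ) (N : ℕ) :
    ∃ C : ℝ, 0 ≤ C ∧ ∀ r : ℝ, 2 * rPlus M a + 1 ≤ r →
      ‖(delta M a r : ℂ) * outgoingPDeriv2 M 0 ω (outgoingCoeff M a ω m lam c₀) N r +
          2 * ((r - M : ℝ) : ℂ) * outgoingPDeriv M 0 ω (outgoingCoeff M a ω m lam c₀) N r +
          ((((radialK a ω m r) ^ 2 : ℝ) : ℂ) / (delta M a r : ℂ) -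
            ((lam + a ^ 2 * ω ^ 2 - 2 * a * m * ω : ℝ) : ℂ)) * outgoingP M 0 ω (outgoingCoeff M a ω m lam c₀) N r‖ ≤
        C * r ^ (-(N : ℝ) - 1) := by
  set B : ℝ := ∑ t ∈ range 5, ‖outgoingDefect M a ω m lam c₀ (t + 1) N‖ with hB
  have hB0 : 0 ≤ B := Finset.sum_nonneg fun _ _ => norm_nonneg _
  have hrp : 0 < rPlus M a := rPlus_pos hM a
  refine ⟨4 * B, by positivity, fun r hr => ?_⟩
  have hr1 : 1 ≤ r := by linarith
  have hr0 : 0 < r := by linarith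
  have hrr : rPlus M a < r := by linarith
  have hΔ : 0 < delta M a r := delta_pos ha.le hrr
  -- `Δ ≥ r²/4` for `r ≥ 2r₊`
  have hΔr : r ^ 2 / 4 ≤ delta M a r := by
    rw [delta_eq_mul ha.le]
    have h1 : r / 2 ≤ r - rPlus M a := by linarith
    have h2 : r / 2 ≤ r - rMinus M a := by linarith [rMinus_le_rPlus M a]
    nlinarith
  rw [outgoing_truncation_residual_eq M a ω m lam c₀ N hr0 hΔ, norm_mul, norm_mul, norm_outgoingPhase, one_mul,
    norm_div, norm_mul, norm_pow, Complex.norm_real, Complex.norm_real, Complex.norm_real,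
    Real.norm_of_nonneg (Real.rpow_nonneg hr0.le _), Real.norm_of_nonneg hr0.le, Real.norm_of_nonneg hΔ.le]
  have hD := norm_outgoingTruncDefect_le hω M a m lam c₀ N hr1
  rw [← hB] at hD
  have hden : r ^ 2 * (r ^ 2 / 4) ≤ r ^ 2 * delta M a r := mul_le_mul_of_nonneg_left hΔr (by positivity)
  have hden0 : 0 < r ^ 2 * (r ^ 2 / 4) := by positivity
  calc r ^ (-(N : ℝ) - 2) * (‖outgoingTruncDefect M a ω m lam c₀ N r‖ / (r ^ 2 * delta M a r))
      ≤ r ^ (-(N : ℝ) - 2) * (B * r ^ 5 / (r ^ 2 * (r ^ 2 / 4))) := by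
        refine mul_le_mul_of_nonneg_left ?_ (Real.rpow_nonneg hr0.le _)
        exact div_le_div₀ (by positivity) hD hden0 hden
    _ = 4 * B * (r ^ (-(N : ℝ) - 2) * r) := by
        field_simp
    _ = 4 * B * r ^ (-(N : ℝ) - 1) := by
        rw [← Real.rpow_add_one hr0.ne']
        ring_nf

end Costa2019

end Literature.Geometry.Lorentzian.Kerr

end
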